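import Literature.AlgebraicGeometry.ModuliOfAbelianVarieties.SiegelFamilyProductSurfacePolarizations
import HarnessLib

/-!
# `E × E` on the diagonal of the Siegel family: `End(E) = ℤ` without complex multiplication, `E × E ∈ H_{b²+4m²}`,
# elliptic curves of degree `δ` iff `δ² = b² + 4m²` with `gcd(b, m) = 1`, principal polarisations `ab − m² = 1`

Layer `Literature/AlgebraicGeometry/ModuliOfAbelianVarieties`, namespace
`Literature.AlgebraicGeometry.ModuliOfAbelianVarieties.SiegelModuli`; lane `lit-hodgefound` (Track 2 foundations
library, Layer A4), seat `lit-hodgefound-skel-4`, row **A4-63 FILE 3**. Specialisation of FILE 1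
(`SiegelFamilyProductSurfaceNeronSeveri`: Kani's `NS(E_{z₁₁} × E_{z₂₂}) ≅ ℤ ⊕ ℤ ⊕ Hom(E_{z₁₁}, E_{z₂₂})`,
`q̃_{θ_Z} = (x − y)² + 4 deg f`, the cyclic case `Hom = ℤh`: `mem_humbertLocusOfInvariant_iff_of_homInt_eq_zmultiples`,
`exists_ellipticCurve_degree_eq_iff_of_homInt_eq_zmultiples`) and FILE 2 (`SiegelFamilyProductSurfacePolarizations`:
`isPrincipalPolarization_iff_of_homInt_eq_zmultiples`) to the SQUARE `E × E` of one elliptic curve, i.e. the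
diagonal points `Z = diag(τ, τ)` (`z₁₂ = 0`, `z₁₁ = z₂₂ = τ`), where `Hom(E_τ, E_τ) = End(E_τ) ∋ 1` always and
`= ℤ · 1` when `E_τ` has no complex multiplication (`τ` satisfies no quadratic equation over `ℚ`; Silverman VI.5.5,
the tree's `forall_mem_endRingInt_iff` in `ComplexTorusEllipticCurveEndomorphismRing` for `endRingInt` — re-derived
here in three lines for `homInt` from FILE 1's `mem_homInt_ellipticPeriod_iff`).

## Sources followed, verbatim

* E. Kani, *Jacobians isomorphic to a product of two elliptic curves and ternary quadratic forms*, J. Number Theory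
  139 (2014) (held `paper:doi-10-1016-j-jnt-2013-12-006`): §1 Thm. 1 (p0001) "Suppose that `Hom(E₁, E₂) = ℤh ≠ 0`,
  and put `d = deg(h)`"; §2 (5)–(6) (p0005); §3 (9) (p0006) "`{Q̄_θ : θ ∈ P(Q)^{odd}} = gen(x² + 4ny²)`" — here
  `E₁ = E₂ = E` without complex multiplication, `h = 1_E`, `n = d = 1`, and for the PRODUCT polarisation
  `θ = D(1,1,0)` the form `q̄_θ` IS `x² + 4y²` (FILE 1).
* E. Kani, *Curves of genus 2 on abelian surfaces* (preprint), §7 (52) and proof of Prop. 42 (p0033): "Let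
  `θ ∈ 𝒫(A)`, so `θ = D(a, b, ch) ∈ 𝒫(A)`, where `h ∈ Hom(E, E′)` is primitive and `a, b, c ∈ ℤ` satisfy
  `ab − c² deg(h) = 1`".
* J. H. Silverman, *The Arithmetic of Elliptic Curves*, Ch. VI Thm. 5.5 (`End(E_τ) ≅ {α ∈ ℂ : αΛ ⊆ Λ}`; `= ℤ`
  unless `τ` is imaginary quadratic); F. Diamond, J. Shurman, §1.3 p. 28 (`mτ = aτ′ + b`, `m = cτ′ + d`).
* C. Birkenhake, H. Wilhelm, *Humbert surfaces and the Kummer plane*, Trans. AMS 355 (2003), §1 (∗), §4 Prop. 4.8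
  (`H_{δ²}` ↔ elliptic curves of degree `δ`; `H_1` = products).

## Contents (theorems only; no definition, no named fact)

For `Z ∈ 𝔥₂` with `z₁₂ = 0` and `z₁₁ = z₂₂ =: τ` (`X_Z = E_τ × E_τ`, `θ_Z` the product polarisation):
* §A `mem_homInt_iff_of_diag` (`A ∈ End(E_τ) ⟺ A₀₁τ² + (A₁₁ − A₀₀)τ − A₁₀ = 0`), `one_mem_homInt_of_diag`,
  `smul_one_mem_homInt_of_diag`, **`mem_homInt_iff_exists_smul_one_of_not_quadratic`** (`End(E_τ) = ℤ·1` when `τ`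
  is not quadratic over `ℚ`); **`mem_humbertLocusOfInvariant_of_diag`** (EVERY `E × E` lies on `H_{b²+4m²}`,
  `(b, m) ≠ 0`: `H_1, H_4, H_5, H_8, H_9, H_13, …`), `mem_humbertLocusOfInvariant_four_and_five_of_diag`; and for `E`
  WITHOUT complex multiplication: **`mem_humbertLocusOfInvariant_iff_of_diag_of_not_quadratic`**
  (`E × E ∈ H_Δ ⟺ Δ = b² + 4m²`, `(b, m) ≠ 0`), **`exists_ellipticCurve_degree_eq_iff_of_diag_of_not_quadratic`**
  (an elliptic curve of degree `δ` ⟺ `δ² = b² + 4m²`, `gcd(b, m) = 1`),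
  `not_exists_ellipticCurve_degree_three_of_diag_of_not_quadratic` (no elliptic curve of degree `3`),
  **`isPrincipalPolarization_iff_of_diag_of_not_quadratic`** (principal polarisations = `D(a, b, m·1)` with
  `a > 0`, `ab − m² = 1`).

## References

* [Kani2014JacobiansTernaryForms] E. Kani, J. Number Theory 139 (2014) 138–174, §1 Thm. 1, §2 (5)–(6), §3 (9).
* [KaniCurvesGenus2AbelianSurfaces] E. Kani, *Curves of genus 2 on abelian surfaces*, preprint, §7 (52), Prop. 42.
* [Kani1994EllipticCurvesAbelianSurfaces] E. Kani, Manuscripta Math. 84 (1994) 199–223.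
* [SilvermanAEC2009] J. H. Silverman, *The Arithmetic of Elliptic Curves*, Ch. VI Thm. 5.5.
* [DiamondShurman2005] F. Diamond, J. Shurman, *A First Course in Modular Forms*, §1.3.
* [BirkenhakeWilhelm2003] C. Birkenhake, H. Wilhelm, Trans. Amer. Math. Soc. 355 (2003), §1, §4 Prop. 4.8–4.9.
-/

noncomputable section

open scoped ComplexOrder
open Module Function Complex Matrix Set Sum

namespace Literature.AlgebraicGeometry.ModuliOfAbelianVarieties

namespace SiegelModuli

open Literature.NumberTheory.Automorphic (siegelUpperHalfSpace)
open Literature.NumberTheory.ModularForms.SiegelUpperHalfSpace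
open Literature.Geometry.Kaehler Literature.Geometry.Kaehler.ComplexTorus
open Literature.Analysis.Complex Literature.LinearAlgebra.Alternating

/-! ## §A `Hom(E_τ, E_τ)` on the diagonal point `diag(τ, τ)`: the identity, and `End(E_τ) = ℤ` without CM -/

section SelfProduct

variable (Z : siegelUpperHalfSpace 2) (hd : (Z : Matrix (Fin 2) (Fin 2) ℂ) 0 1 = 0)
  (hdiag : (Z : Matrix (Fin 2) (Fin 2) ℂ) 0 0 = (Z : Matrix (Fin 2) (Fin 2) ℂ) 1 1)

include hdiag in
/-- **`Hom(E_τ, E_τ) = End(E_τ)` in the rational representation, at `Z = diag(τ, τ)`**: an integer matrix `A` is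
an endomorphism of `E_τ = ℂ/(ℤτ + ℤ)` iff `A₀₁τ² + (A₁₁ − A₀₀)τ − A₁₀ = 0` (the analytic representation being
`z ↦ (A₀₁τ + A₁₁)z`; Silverman VI.5.5: `End(E_τ) = {α : αΛ ⊆ Λ}`).
[cite: SilvermanAEC2009, Ch. VI Thm. 5.5] [cite: DiamondShurman2005, §1.3 p. 28] -/
theorem mem_homInt_iff_of_diag (A : Matrix (Fin 2) (Fin 2) ℤ) :
    A ∈ homInt (fstPeriod Z) (sndPeriod Z) ↔
      (A 0 1 : ℂ) * ((Z : Matrix (Fin 2) (Fin 2) ℂ) 0 0) ^ 2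
        + ((A 1 1 : ℂ) - A 0 0) * (Z : Matrix (Fin 2) (Fin 2) ℂ) 0 0 - A 1 0 = 0 := by
  rw [mem_homInt_ellipticPeriod_iff, coe_fstModulus, coe_sndModulus, ← hdiag]
  constructor <;> intro h <;> linear_combination h

include hdiag in
/-- **The identity is an endomorphism**: `1 ∈ Hom(E_{z₁₁}, E_{z₂₂})` when `z₁₁ = z₂₂` (the graph of the identity,
the diagonal of `E × E`). [cite: SilvermanAEC2009, Ch. VI Thm. 5.5] -/
theorem one_mem_homInt_of_diag : (1 : Matrix (Fin 2) (Fin 2) ℤ) ∈ homInt (fstPeriod Z) (sndPeriod Z) := by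
  rw [mem_homInt_iff_of_diag Z hdiag]
  simp

include hdiag in
/-- Every integer multiple of the identity is an endomorphism: `ℤ · 1 ⊆ End(E_τ)`. [cite: SilvermanAEC2009, Ch. VI Thm. 5.5] -/
theorem smul_one_mem_homInt_of_diag (m : ℤ) : m • (1 : Matrix (Fin 2) (Fin 2) ℤ) ∈ homInt (fstPeriod Z) (sndPeriod Z) :=
  (homInt _ _).zsmul_mem (one_mem_homInt_of_diag Z hdiag) m

include hdiag in
/-- **`End(E_τ) = ℤ` WITHOUT COMPLEX MULTIPLICATION (Silverman VI.5.5 (i))**: if `τ = z₁₁ = z₂₂` satisfies no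
quadratic equation over `ℚ`, then `Hom(E_τ, E_τ) = ℤ · 1` in the rational representation (the tree's
`forall_mem_endRingInt_iff` for `endRingInt`; here directly from `A₀₁τ² + (A₁₁ − A₀₀)τ − A₁₀ = 0`).
[cite: SilvermanAEC2009, Ch. VI Thm. 5.5 (i)] [cite: Kani2014JacobiansTernaryForms, §1 Thm. 1 (`Hom(E₁, E₂) = ℤh`, here `h = 1_E`, `d = 1`)] -/
theorem mem_homInt_iff_exists_smul_one_of_not_quadratic
    (hnq : ∀ p q : ℚ, ((Z : Matrix (Fin 2) (Fin 2) ℂ) 0 0) ^ 2 + p * (Z : Matrix (Fin 2) (Fin 2) ℂ) 0 0 + q ≠ 0)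
    (A : Matrix (Fin 2) (Fin 2) ℤ) :
    A ∈ homInt (fstPeriod Z) (sndPeriod Z) ↔ ∃ m : ℤ, A = m • (1 : Matrix (Fin 2) (Fin 2) ℤ) := by
  constructor
  · intro hA
    rw [mem_homInt_iff_of_diag Z hdiag] at hA
    set τ := (Z : Matrix (Fin 2) (Fin 2) ℂ) 0 0 with hτ
    have hτim : τ.im ≠ 0 := (im_apply_zero_zero_pos Z).ne'
    -- `A₀₁ = 0`: otherwise `τ` is quadratic over `ℚ`
    have h01 : A 0 1 = 0 := by
      by_contra h01
      apply hnq (((A 1 1 : ℤ) - A 0 0 : ℚ) / (A 0 1 : ℚ)) (-(A 1 0 : ℚ) / (A 0 1 : ℚ))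
      have h01c : (A 0 1 : ℂ) ≠ 0 := by exact_mod_cast h01
      push_cast
      field_simp
      linear_combination hA
    rw [h01, Int.cast_zero, zero_mul, zero_add] at hA
    -- then `(A₁₁ − A₀₀)τ = A₁₀` with `Im τ ≠ 0` forces `A₁₁ = A₀₀` and `A₁₀ = 0`
    have him := congrArg Complex.im hA
    simp only [sub_im, mul_im, sub_re, intCast_re, intCast_im, sub_self, zero_mul, add_zero, zero_im,
      sub_zero] at him
    have h1100 : (A 1 1 : ℝ) - A 0 0 = 0 := by
      rcases mul_eq_zero.1 him with h | h
      · exact h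
      · exact absurd h hτim
    have h11 : A 1 1 = A 0 0 := by
      have : ((A 1 1 - A 0 0 : ℤ) : ℝ) = 0 := by push_cast; exact h1100
      exact_mod_cast (sub_eq_zero.1 (by exact_mod_cast this : (A 1 1 : ℤ) - A 0 0 = 0))
    have h1100c : (A 1 1 : ℂ) - A 0 0 = 0 := by rw [h11, sub_self]
    rw [h1100c, zero_mul, zero_sub, neg_eq_zero] at hA
    have h10 : A 1 0 = 0 := by exact_mod_cast hA
    refine ⟨A 0 0, ?_⟩
    ext i j
    fin_cases i <;> fin_cases j <;> simp [h01, h10, h11]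
  · rintro ⟨m, rfl⟩
    exact smul_one_mem_homInt_of_diag Z hdiag m

include hd hdiag in
/-- **`E × E` LIES ON `H_Δ` FOR EVERY `Δ = b² + 4m² > 0`** (ANY elliptic curve `E = E_τ`, `Z = diag(τ, τ)`): the
classes `(b, m · 1_E)`, `(b, m) ≠ (0, 0)`, are singular relations of invariant `b² + 4m²` — so
`E × E ∈ H_1 ∩ H_4 ∩ H_5 ∩ H_8 ∩ H_9 ∩ H_13 ∩ ⋯` (the form `x² + 4y²` of Kani's (9) for `n = deg 1_E = 1`).
[cite: Kani2014JacobiansTernaryForms, §3 eq. (9) (`gen(x² + 4ny²)`) with §1 Thm. 1 (`d = 1`)] [cite: BirkenhakeWilhelm2003, §1 (∗) and §4 Prop. 4.8–4.9] -/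
theorem mem_humbertLocusOfInvariant_of_diag {b m : ℤ} (hne : b ≠ 0 ∨ m ≠ 0) :
    Z ∈ humbertLocusOfInvariant (b ^ 2 + 4 * m ^ 2) := by
  refine (mem_humbertLocusOfInvariant_iff_exists_homInt Z hd).2 ⟨b, m • 1, ?_, smul_one_mem_homInt_of_diag Z hdiag m, ?_⟩
  · rcases hne with hb | hm
    · exact Or.inl hb
    · right
      intro h0
      apply hm
      have h := congrFun (congrFun h0 0) 0
      simpa using h
  · rw [Matrix.det_fin_two]
    simp only [Matrix.smul_apply, Matrix.one_apply_eq, Matrix.one_apply_ne (show (0 : Fin 2) ≠ 1 by decide),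
      Matrix.one_apply_ne (show (1 : Fin 2) ≠ 0 by decide), smul_eq_mul, mul_one, mul_zero]
    ring

include hd hdiag in
/-- In particular `E × E` lies on `H_4` (the class `(0, 1_E)`: the relation of the graph of the identity / of `−1`,
an elliptic curve of degree `2`) and on `H_5` (`(1, 1_E)`), besides `H_1`.
[cite: Kani2014JacobiansTernaryForms, §3 eq. (9) and §1 Thm. 1] [cite: BirkenhakeWilhelm2003, §4 Prop. 4.8] -/
theorem mem_humbertLocusOfInvariant_four_and_five_of_diag :
    Z ∈ humbertLocusOfInvariant 4 ∧ Z ∈ humbertLocusOfInvariant 5 :=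
  ⟨by simpa using mem_humbertLocusOfInvariant_of_diag Z hd hdiag (b := 0) (m := 1) (Or.inr one_ne_zero),
    by simpa using mem_humbertLocusOfInvariant_of_diag Z hd hdiag (b := 1) (m := 1) (Or.inl one_ne_zero)⟩

variable (hnq : ∀ p q : ℚ, ((Z : Matrix (Fin 2) (Fin 2) ℂ) 0 0) ^ 2 + p * (Z : Matrix (Fin 2) (Fin 2) ℂ) 0 0 + q ≠ 0)

include hd hdiag hnq in
/-- **THE HUMBERT SURFACES THROUGH `E × E`, `E` WITHOUT COMPLEX MULTIPLICATION: `E × E ∈ H_Δ ⟺ Δ = b² + 4m²`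
for some `(b, m) ≠ (0, 0)`** — `q̄_θ = x² + 4y²` on `NS(E × E)/ℤθ = ℤ ⊕ End(E) = ℤ²` (Kani's (9) with `n = 1`;
FILE 1 `mem_humbertLocusOfInvariant_iff_of_homInt_eq_zmultiples` with `h = 1_E`).
[cite: Kani2014JacobiansTernaryForms, §3 eq. (9) and §1 Thm. 1 (`Hom(E, E) = ℤ·1`, `d = 1`)] [cite: SilvermanAEC2009, Ch. VI Thm. 5.5 (i)] -/
theorem mem_humbertLocusOfInvariant_iff_of_diag_of_not_quadratic {Δ : ℤ} :
    Z ∈ humbertLocusOfInvariant Δ ↔ ∃ b m : ℤ, (b ≠ 0 ∨ m ≠ 0) ∧ Δ = b ^ 2 + 4 * m ^ 2 := by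
  rw [mem_humbertLocusOfInvariant_iff_of_homInt_eq_zmultiples Z hd
    (mem_homInt_iff_exists_smul_one_of_not_quadratic Z hdiag hnq) one_ne_zero]
  simp [Matrix.det_one]

include hd hdiag hnq in
/-- **ELLIPTIC CURVES ON `E × E` (`E` without complex multiplication) BY DEGREE: an elliptic curve of degree `δ`
(with respect to the product polarisation) exists iff `δ² = b² + 4m²` with `gcd(b, m) = 1`** — `δ = 1` (fibres),
`δ = 2` (the diagonal and the antidiagonal), `δ = 5`, `δ = 10`, … (FILE 1
`exists_ellipticCurve_degree_eq_iff_of_homInt_eq_zmultiples` with `h = 1_E`).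
[cite: Kani1994EllipticCurvesAbelianSurfaces] [cite: Kani2014JacobiansTernaryForms, §3 (9), §1 Thm. 1] [cite: BirkenhakeWilhelm2003, §4 Prop. 4.8] -/
theorem exists_ellipticCurve_degree_eq_iff_of_diag_of_not_quadratic {δ : ℤ} (hδ : 0 < δ) :
    (∃ Y : SubtorusFrame (prinPeriod Z) 2,
        (δ : ℝ) = -prinForm Z ![latticeVec (prinPeriod Z) (Y.frame 0), latticeVec (prinPeriod Z) (Y.frame 1)]) ↔
      ∃ b m : ℤ, IsCoprime b m ∧ δ ^ 2 = b ^ 2 + 4 * m ^ 2 := by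
  rw [exists_ellipticCurve_degree_eq_iff_of_homInt_eq_zmultiples Z hd
    (mem_homInt_iff_exists_smul_one_of_not_quadratic Z hdiag hnq) one_ne_zero hδ]
  simp [Matrix.det_one]

include hd hdiag hnq in
/-- **`E × E` (`E` without CM) contains NO elliptic curve of degree `3`**: `9 = b² + 4m²` forces `(b, m) = (±3, 0)`,
not coprime (the degrees are `1, 2, 5, 10, 13, …`). [cite: Kani1994EllipticCurvesAbelianSurfaces] [cite: Kani2014JacobiansTernaryForms, §3 (9)] -/
theorem not_exists_ellipticCurve_degree_three_of_diag_of_not_quadratic :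
    ¬ ∃ Y : SubtorusFrame (prinPeriod Z) 2,
        ((3 : ℤ) : ℝ) = -prinForm Z ![latticeVec (prinPeriod Z) (Y.frame 0), latticeVec (prinPeriod Z) (Y.frame 1)] := by
  rw [exists_ellipticCurve_degree_eq_iff_of_diag_of_not_quadratic Z hd hdiag hnq (by norm_num)]
  rintro ⟨b, m, hcop, h⟩
  have hm : m ^ 2 ≤ 2 := by nlinarith [sq_nonneg b]
  have hm' : m = 0 ∨ m = 1 ∨ m = -1 := by
    have : -1 ≤ m ∧ m ≤ 1 := by constructor <;> nlinarith
    omega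
  rcases hm' with rfl | rfl | rfl
  · -- `b² = 9`, `(b, 0)` coprime forces `b = ±1`
    have hb := Int.isCoprime_iff_gcd_eq_one.1 hcop
    rw [Int.gcd_zero_right] at hb
    have : b ^ 2 = 1 := by
      have hb' : b.natAbs = 1 := hb
      rcases Int.natAbs_eq_iff.1 hb' with rfl | rfl <;> norm_num
    omega
  · have : b ^ 2 = 5 := by linarith
    have hb : -2 ≤ b ∧ b ≤ 2 := by constructor <;> nlinarith
    obtain ⟨h1, h2⟩ := hb
    interval_cases b <;> omega
  · have : b ^ 2 = 5 := by linarith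
    have hb : -2 ≤ b ∧ b ≤ 2 := by constructor <;> nlinarith
    obtain ⟨h1, h2⟩ := hb
    interval_cases b <;> omega

include hd hdiag hnq in
/-- **The principal polarisations of `E × E` (`E` without CM)**: the classes `D(a, b, m·1_E)` with `a > 0` and
`ab − m² = 1` (FILE 2 `isPrincipalPolarization_iff_of_homInt_eq_zmultiples` with `h = 1_E`, `n = 1`) — infinitely
many (`(1, 1, 0) = θ_Z`, `(1, 2, ±1)`, `(2, 1, ±1)`, `(1, 5, ±2)`, …), in contrast with the non-isogenous case
`𝒫(E × E′) = {θ}`. [cite: KaniCurvesGenus2AbelianSurfaces, §7 (52) and proof of Prop. 42] [cite: Kani2014JacobiansTernaryForms, §1 Thm. 1 (`d = 1`)] -/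
theorem isPrincipalPolarization_iff_of_diag_of_not_quadratic (η : neronSeveriGroup (prinPeriod Z)) :
    IsPrincipalPolarization (prinPeriod Z) (η : (Fin 2 → ℂ) [⋀^Fin 2]→L[ℝ] ℝ) ↔
      ∃ m : ℤ, ((neronSeveriProdEquiv Z hd η).2.2 : Matrix (Fin 2) (Fin 2) ℤ) = m • (1 : Matrix (Fin 2) (Fin 2) ℤ) ∧
        0 < (neronSeveriProdEquiv Z hd η).1 ∧
          (neronSeveriProdEquiv Z hd η).1 * (neronSeveriProdEquiv Z hd η).2.1 - m ^ 2 = 1 := by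
  rw [isPrincipalPolarization_iff_of_homInt_eq_zmultiples Z hd
    (mem_homInt_iff_exists_smul_one_of_not_quadratic Z hdiag hnq) η]
  simp [Matrix.det_one]

end SelfProduct

end SiegelModuli

end Literature.AlgebraicGeometry.ModuliOfAbelianVarieties

end
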